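import Literature.NumberTheory.PAdicHodge.BmaxPlusFrobeniusImage
import Literature.NumberTheory.PAdicHodge.AinfAdicComplete
import HarnessLib

/-!
# `⋂ₙ φⁿ(A_max) = 𝔸_inf`: an element of `A_max` lying in every `φⁿ(A_max)` comes from `𝔸_inf`

Topic `Literature/NumberTheory/PAdicHodge`; namespace `Literature.NumberTheory.PAdicHodge`. THEOREMS ONLY (no definition, no named
fact, no instance). Continuation of `BmaxPlusFrobeniusImage` (`φⁿ(A_max) ⊆ 𝔸_inf + p^{n(p−1)}A_max`) on Colmez's `A_max = B_max⁺(F)`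
(`BmaxPlus`; `ι : 𝔸_inf → A_max`, `T = ξ/p = omegaB`).

* `mem_span_p_xi_pow_of_algebraMap_mem_pow` — **`𝔸_inf ∩ pᴺ·B⁰_max = (p, ξ)ᴺ`** (induction on `N` with `θ`, `ker θ = ξ𝔸_inf` and the
  regularity of `ξ/p` modulo `pᴺ`; the case `N = 1` is `BmaxPlusTheta.mem_span_p_xi_of_algebraMap_mem`);
* `exists_eq_ainfToBmaxPlus_of_forall_evalₐ_eq` — **`ι(𝔸_inf)` is closed in `A_max`**: if every `z mod pᴺ` is the class of an element
  of `𝔸_inf` then `z ∈ ι(𝔸_inf)` (the representatives are `(p, ξ)`-adically Cauchy; `𝔸_inf` is `(p, ξ)`-adically complete, tree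
  `isAdicComplete_span_p_xi`);
* ★ `exists_eq_ainfToBmaxPlus_of_forall_mem_range_frobBmaxPlus_iterate` — **`⋂ₙ φⁿ(A_max) ⊆ ι(𝔸_inf)`**: if `z = φⁿ(Hₙ)` for every `n`
  then `z = ι(a)` (Frobenius contracts `A_max` towards `𝔸_inf`: `φⁿ(A_max) ⊆ ι(𝔸_inf) + p^{n(p−1)}A_max`). Equivalently: a function bounded
  by `1` on all the discs `|[p♭]| ≤ |p|^{p^{−n}}` is bounded on the punctured open unit disc, hence lies in `𝔸_inf`.

Step (L0) of the `t`-divisibility theorem (TDIV) for `(A_max)^{φ=p} ∩ ker θ` (brick B7 of the φ-road of line `kato_lever`,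
crux K★ `stmt-BirchSwinnertonDyer-22226`, memo `Cruxes/StarredOptimalManinUnitFiveSeven/Lines/kato-lever-K2-fontaine-lemma-g24.md`).
Infrastructure only: BSD / K★ are not proved by any of this.

## References
* [Colmez1998Annals] P. Colmez, *Théorie d'Iwasawa des représentations de de Rham d'un corps local*, Ann. of Math. 148 (1998), §III.2.
* [FontaineAsterisque223III] J.-M. Fontaine, *Le corps des périodes p-adiques*, Astérisque 223 (1994), Exp. II §1.3, §2.3.
-/

noncomputable section

open WittVector Field ValuativeRel Polynomial Finset
open Literature.AlgebraicGeometry.Resolution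

namespace Literature.NumberTheory.PAdicHodge

open Literature.NumberTheory.GaloisRepresentations
open Literature.NumberTheory.GaloisRepresentations.IsNonarchimedeanLocalField

variable {F : Type} [Field F] [ValuativeRel F] [TopologicalSpace F] [IsNonarchimedeanLocalField F]
  [CharZero F] {p : ℕ} [Fact p.Prime] [Fact (¬ IsUnit (p : integerC F))]
  [IsAdicComplete (Ideal.span {(p : integerC F)}) (integerC F)]

/-! ### `𝔸_inf ∩ pᴺ·B⁰_max = (p, ξ)ᴺ` -/

set_option maxHeartbeats 1600000 in
set_option synthInstance.maxHeartbeats 400000 in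
/-- **`𝔸_inf ∩ pᴺ·B⁰_max ⊆ (p, ξ)ᴺ`**: if `a ∈ 𝔸_inf` becomes divisible by `pᴺ` in `B⁰_max = 𝔸_inf[ξ/p]` then `a ∈ (p, ξ)ᴺ`. Induction on `N`:
`a = pb + ξc` with `b + (ξ/p)c ∈ p^N B⁰_max`; then `θ(b) ∈ p^N𝒪`, so `b = ξb' + p^N b''`, and `(ξ/p)(pb' + c) ∈ p^N B⁰_max` forces
`pb' + c ∈ (p,ξ)^N` (`ξ/p` is regular mod `p^N`), whence `a = p^{N+1}b'' + ξ(pb' + c) ∈ (p,ξ)^{N+1}`. [cite: Colmez1998Annals, §III.2] -/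
theorem mem_span_p_xi_pow_of_algebraMap_mem_pow (hF : Function.Surjective (fontaineTheta (integerC F) p)) (N : ℕ) :
    ∀ {a : Ainf (p := p) F}, algebraMap (Ainf (p := p) F) (bmaxZero F p) a ∈ Ideal.span {(p : bmaxZero F p)} ^ N →
      a ∈ Ideal.span {(p : Ainf (p := p) F), xi} ^ N := by
  induction N with
  | zero => intro a _; rw [pow_zero, Ideal.one_eq_top]; exact Submodule.mem_top
  | succ N ih =>
    intro a ha
    have ha1 : algebraMap (Ainf (p := p) F) (bmaxZero F p) a ∈ Ideal.span {(p : bmaxZero F p)} :=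
      Ideal.pow_le_self (I := Ideal.span {(p : bmaxZero F p)}) (Nat.succ_ne_zero N) ha
    obtain ⟨b, c, hbc⟩ := Ideal.mem_span_pair.1 (mem_span_p_xi_of_algebraMap_mem hF ha1)
    rw [Ideal.span_singleton_pow, Ideal.mem_span_singleton'] at ha
    obtain ⟨w, hw⟩ := ha
    -- `b + (ξ/p) c = p^N w`
    have h1 : algebraMap (Ainf (p := p) F) (bmaxZero F p) b + omegaB * algebraMap (Ainf (p := p) F) (bmaxZero F p) c =
        (p : bmaxZero F p) ^ N * w := by
      refine eq_of_natCast_pow_mul_eq (p := p) (F := F) (v := 1) ?_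
      have e : algebraMap (Ainf (p := p) F) (bmaxZero F p) a =
          (p : bmaxZero F p) * (algebraMap (Ainf (p := p) F) (bmaxZero F p) b + omegaB * algebraMap (Ainf (p := p) F) (bmaxZero F p) c) := by
        rw [← hbc, map_add, map_mul, map_mul, map_natCast, ← natCast_mul_omegaB]; ring
      rw [pow_one, ← e, ← hw, pow_succ]; ring
    -- `θ(b) = p^N θ⁰(w)`, so `b = ξ b' + p^N b''`
    have h2 : fontaineTheta (integerC F) p b = (p : integerC F) ^ N * thetaBmaxZero F p w := by
      have h := congrArg (thetaBmaxZero F p) h1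
      simp only [map_add, map_mul, thetaBmaxZero_omegaB, zero_mul, add_zero, thetaBmaxZero_algebraMap, map_pow,
        thetaBmaxZero_natCast] at h
      exact h
    obtain ⟨b'', hb''⟩ := hF (thetaBmaxZero F p w)
    have h3 : fontaineTheta (integerC F) p (b - (p : Ainf (p := p) F) ^ N * b'') = 0 := by
      rw [map_sub, map_mul, map_pow, map_natCast, hb'', h2, sub_self]
    obtain ⟨b', hb'⟩ := xi_dvd_of_fontaineTheta_eq_zero h3
    -- `(ξ/p)(p b' + c) = p^N (w − b'')`
    have h4 : omegaB * algebraMap (Ainf (p := p) F) (bmaxZero F p) ((p : Ainf (p := p) F) * b' + c) ∈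
        Ideal.span {(p : bmaxZero F p)} ^ N := by
      rw [Ideal.span_singleton_pow, Ideal.mem_span_singleton']
      refine ⟨w - algebraMap (Ainf (p := p) F) (bmaxZero F p) b'', ?_⟩
      have e : algebraMap (Ainf (p := p) F) (bmaxZero F p) b =
          (p : bmaxZero F p) * omegaB * algebraMap (Ainf (p := p) F) (bmaxZero F p) b' +
            (p : bmaxZero F p) ^ N * algebraMap (Ainf (p := p) F) (bmaxZero F p) b'' := by
        rw [show b = xi * b' + (p : Ainf (p := p) F) ^ N * b'' by rw [← hb', sub_add_cancel], map_add, map_mul, map_mul, map_pow,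
          map_natCast, ← natCast_mul_omegaB]
      rw [map_add, map_mul, map_natCast]
      linear_combination e - h1
    have h5 := ih (mem_span_pow_of_omegaB_mul_mem N h4)
    -- conclude
    have e : a = (p : Ainf (p := p) F) ^ (N + 1) * b'' + ((p : Ainf (p := p) F) * b' + c) * xi := by
      rw [← hbc, show b = xi * b' + (p : Ainf (p := p) F) ^ N * b'' by rw [← hb', sub_add_cancel], pow_succ]; ring
    have hp𝔞 : (p : Ainf (p := p) F) ∈ Ideal.span {(p : Ainf (p := p) F), xi} := Ideal.subset_span (Set.mem_insert _ _)
    have hξ𝔞 : (xi : Ainf (p := p) F) ∈ Ideal.span {(p : Ainf (p := p) F), xi} :=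
      Ideal.subset_span (Set.mem_insert_of_mem _ (Set.mem_singleton _))
    rw [e]
    refine add_mem (Ideal.mul_mem_right _ _ (Ideal.pow_mem_pow hp𝔞 (N + 1))) ?_
    rw [pow_succ]
    exact Ideal.mul_mem_mul h5 hξ𝔞

omit [CharZero F] [IsAdicComplete (Ideal.span {(p : integerC F)}) (integerC F)] in
/-- `(p, ξ)ᴺ ↦ pᴺ·B⁰_max` under `𝔸_inf → B⁰_max`. [cite: Colmez1998Annals, §III.2] -/
theorem algebraMap_mem_pow_of_mem_span_p_xi_pow {N : ℕ} {a : Ainf (p := p) F} (ha : a ∈ Ideal.span {(p : Ainf (p := p) F), xi} ^ N) :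
    algebraMap (Ainf (p := p) F) (bmaxZero F p) a ∈ Ideal.span {(p : bmaxZero F p)} ^ N := by
  have hle : (Ideal.span {(p : Ainf (p := p) F), xi}).map (algebraMap (Ainf (p := p) F) (bmaxZero F p)) ≤ Ideal.span {(p : bmaxZero F p)} := by
    rw [Ideal.map_le_iff_le_comap]
    intro x hx
    exact algebraMap_mem_span_of_mem_span_p_xi hx
  have h := Ideal.mem_map_of_mem (algebraMap (Ainf (p := p) F) (bmaxZero F p)) ha
  rw [Ideal.map_pow] at h
  exact Ideal.pow_right_mono hle N h

/-! ### `ι(𝔸_inf)` is closed in `A_max` -/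

set_option maxHeartbeats 1600000 in
set_option synthInstance.maxHeartbeats 400000 in
/-- **`ι(𝔸_inf)` is `p`-adically closed in `A_max`**: if for every `N` the class `z mod pᴺ` is represented by some `aₙ ∈ 𝔸_inf`, then
`z = ι(a)` for some `a ∈ 𝔸_inf` (the `a_N` are `(p, ξ)`-adically Cauchy by `𝔸_inf ∩ pᴺB⁰_max = (p,ξ)ᴺ`, and `𝔸_inf` is
`(p, ξ)`-adically complete). [cite: Colmez1998Annals, §III.2] -/
theorem exists_eq_ainfToBmaxPlus_of_forall_evalₐ_eq (hF : Function.Surjective (fontaineTheta (integerC F) p)) {z : BmaxPlus F p}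
    (a : ℕ → Ainf (p := p) F)
    (hz : ∀ N, AdicCompletion.evalₐ (Ideal.span {(p : bmaxZero F p)}) N z =
      Ideal.Quotient.mk _ (algebraMap (Ainf (p := p) F) (bmaxZero F p) (a N))) :
    ∃ L : Ainf (p := p) F, z = ainfToBmaxPlus F p L := by
  -- the `a N` are `(p, ξ)`-adically Cauchy
  have hdiff : ∀ N, a (N + 1) - a N ∈ Ideal.span {(p : Ainf (p := p) F), xi} ^ N := by
    intro N
    refine mem_span_p_xi_pow_of_algebraMap_mem_pow hF N ?_
    have h := factorPow_evalₐ (Ideal.span {(p : bmaxZero F p)}) (Nat.le_succ N) z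
    have e : Ideal.Quotient.mk (Ideal.span {(p : bmaxZero F p)} ^ N) (algebraMap (Ainf (p := p) F) (bmaxZero F p) (a (N + 1))) =
        Ideal.Quotient.mk (Ideal.span {(p : bmaxZero F p)} ^ N) (algebraMap (Ainf (p := p) F) (bmaxZero F p) (a N)) :=
      calc Ideal.Quotient.mk (Ideal.span {(p : bmaxZero F p)} ^ N) (algebraMap (Ainf (p := p) F) (bmaxZero F p) (a (N + 1)))
          = Ideal.Quotient.factorPow (Ideal.span {(p : bmaxZero F p)}) (Nat.le_succ N)
              (Ideal.Quotient.mk (Ideal.span {(p : bmaxZero F p)} ^ (N + 1)) (algebraMap (Ainf (p := p) F) (bmaxZero F p) (a (N + 1)))) :=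
            (Ideal.Quotient.factor_mk _ _).symm
        _ = Ideal.Quotient.factorPow (Ideal.span {(p : bmaxZero F p)}) (Nat.le_succ N)
              (AdicCompletion.evalₐ (Ideal.span {(p : bmaxZero F p)}) (N + 1) z) := congrArg _ (hz (N + 1)).symm
        _ = AdicCompletion.evalₐ (Ideal.span {(p : bmaxZero F p)}) N z := h
        _ = _ := hz N
    have e' := (Ideal.Quotient.eq).1 e
    rwa [← map_sub] at e'
  have htel : ∀ {m n : ℕ}, m ≤ n → a n - a m ∈ Ideal.span {(p : Ainf (p := p) F), xi} ^ m := by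
    intro m n hmn
    induction n, hmn using Nat.le_induction with
    | base => rw [sub_self]; exact Submodule.zero_mem _
    | succ n hmn ih =>
      have e : a (n + 1) - a m = (a (n + 1) - a n) + (a n - a m) := by ring
      rw [e]
      exact add_mem (Ideal.pow_le_pow_right hmn (hdiff n)) ih
  haveI := isAdicComplete_span_p_xi (F := F) (p := p)
  have hcauchy : ∀ {m n : ℕ}, m ≤ n → a m ≡ a n [SMOD (Ideal.span {(p : Ainf (p := p) F), xi} ^ m • ⊤ :
      Submodule (Ainf (p := p) F) (Ainf (p := p) F))] := by
    intro m n hmn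
    rw [smul_eq_mul, Ideal.mul_top, SModEq.sub_mem, ← neg_sub]
    exact neg_mem (htel hmn)
  obtain ⟨L, hL⟩ := IsPrecomplete.prec (IsAdicComplete.toIsPrecomplete (I := Ideal.span {(p : Ainf (p := p) F), xi})) hcauchy
  refine ⟨L, AdicCompletion.ext_evalₐ fun N => ?_⟩
  rw [hz N, evalₐ_ainfToBmaxPlus, Ideal.Quotient.eq, ← map_sub]
  have hN := hL N
  rw [smul_eq_mul, Ideal.mul_top, SModEq.sub_mem] at hN
  exact algebraMap_mem_pow_of_mem_span_p_xi_pow hN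

/-! ### `⋂ₙ φⁿ(A_max) ⊆ ι(𝔸_inf)` -/

set_option maxHeartbeats 1600000 in
/-- ★ **`⋂ₙ φⁿ(A_max) ⊆ ι(𝔸_inf)`**: if `z ∈ A_max = B_max⁺(F)` lies in `φⁿ(A_max)` for every `n`, then `z = ι(a)` for some `a ∈ 𝔸_inf`
(`φⁿ(A_max) ⊆ ι(𝔸_inf) + p^{n(p−1)}A_max` and `ι(𝔸_inf)` is closed). In the language of functions on the disc `|[p♭]| ≤ |p|`: a function
extending with bound `1` to every disc `|[p♭]| ≤ |p|^{p^{−n}}` is a bounded function on the open unit disc, i.e. an element of `𝔸_inf`.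
[cite: Colmez1998Annals, §III.2] -/
theorem exists_eq_ainfToBmaxPlus_of_forall_mem_range_frobBmaxPlus_iterate (hF : Function.Surjective (fontaineTheta (integerC F) p))
    {z : BmaxPlus F p} (hz : ∀ n, ∃ H : BmaxPlus F p, z = (frobBmaxPlus F p)^[n] H) :
    ∃ a : Ainf (p := p) F, z = ainfToBmaxPlus F p a := by
  have hp1 : 1 ≤ p - 1 := Nat.le_sub_one_of_lt (Fact.out : p.Prime).one_lt
  have hrep : ∀ N, ∃ a : Ainf (p := p) F, AdicCompletion.evalₐ (Ideal.span {(p : bmaxZero F p)}) N z =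
      Ideal.Quotient.mk _ (algebraMap (Ainf (p := p) F) (bmaxZero F p) a) := by
    intro N
    obtain ⟨H, hH⟩ := hz N
    obtain ⟨a, ha⟩ := exists_evalₐ_frobBmaxPlus_iterate_eq_mk_algebraMap H (n := N) (N := N)
      (by calc N = N * 1 := (mul_one N).symm
        _ ≤ N * (p - 1) := Nat.mul_le_mul_left N hp1)
    exact ⟨a, by rw [hH]; exact ha⟩
  choose a ha using hrep
  exact exists_eq_ainfToBmaxPlus_of_forall_evalₐ_eq hF a ha

end Literature.NumberTheory.PAdicHodge

end
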